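import Summits.CriticalPhenomena.PercolationContinuityZ3.Theorems.PercNearOneGluingNoHeavyLowerTailSahiAllButOnePoly
import Summits.CriticalPhenomena.PercolationContinuityZ3.Theorems.PercNearOneGluingNoHeavyLowerTailSahiTransportSigma

/-!
# `NoHeavyLowerTail` (crux stmt-CriticalPhenomena-4575), Sahi / Kahn positivity: the ALL-BUT-ONE slot (II) — patterns, weights, trace reduction

Support file (cell `prim-l12`, seat P3, gen 8; `--supports stmt-CriticalPhenomena-4575`).  No `sorry`, no named facts, standard axioms.
New mathematics (this programme).

**THEOREM (Kahn's Conjecture 5 / Sahi's `C₃` for the ALL-BUT-ONE first slot).**  Let `A` be a finite block of coordinates of a finite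
product space with parameters in `(0,1)` on `A`, and `H = {ω : at most one coordinate of A is closed}` (the threshold event `Th_{|A|−1}^A`;
`|A| = 3` is majority, for `|A| ≥ 5` these events are neither read-once nor covered by the cascade/junta theorems of the tree).  Then
`E₃(1_H, 1_U, 1_V) ≥ 0` for ALL increasing `U, V`, in every dimension (`sahiE_three_nonneg_of_allButOne`).

PROOF.  The probability vector `ρ = μ(· | exactly one coordinate closed)` on the pattern cube is a reduced transport certificate
(`rhoCert_allButOne`, `…SahiTransportRho.RhoCert`), whence the theorem by `sahiE_three_nonneg_of_rhoCert`.  Ingredients: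
* `pr_inter_allButOne`: `w(H_k ∩ 𝒴) = w(⊤)·1_𝒴(⊤) + Σ_i w(⊤∖i)·1_𝒴(⊤∖i)`; the weights `w(⊤) = ∏ q =: W`, `w(⊤∖i) = W·r_i`, `r_i = (1−q_i)/q_i`;
* TRACE REDUCTION: an up-set `𝒳` lies in the cylinder over `core 𝒳 = {i : ⊤∖i ∉ 𝒳}` and has the same trace on `H_k`; the right side of (TC)
  is antitone in `w(𝒳), w(𝒵)` (two Harris inequalities), so (TC) and (o) need only be checked on cylinder pairs;
* on a cylinder pair (TC) is the polynomial inequality `…SahiAllButOnePoly.allButOne_cylPair_poly` in the four regions of `(core 𝒳, core 𝒵)`,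
  (o) and (a) follow from `∏(1+r)(1−Σr) ≤ 1`.
Numerically (seat gen 8) the same law `μ(· | exactly t blocks full)` certifies every threshold-of-disjoint-cylinders event
`{≥ t of the blocks B_1,…,B_r fully open}` through `k = 7`; this file proves the case `t = r − 1`, `|B_i| = 1`. [this work]
-/

noncomputable section

open scoped Classical

namespace Summit.CriticalPhenomena.PercolationContinuityZ3.Theorems

namespace SahiAllButOne

open Finset
open SahiHittingSlot SahiTransportCert
open Literature.Combinatorics.Sahi2008
open Literature.Probability.Percolation (DeterminedBy determinedBy_iff)
open Literature.Probability.Percolation.BHK2006 (weight ind_inter)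
open Literature.Probability.Percolation.DecisionTree (ind ind_of_mem ind_of_not_mem ind_nonneg)

variable {k : ℕ}

/-! ### The pattern event and its `k + 1` patterns -/

/-- The ALL-BUT-ONE pattern event: at most one coordinate of the block is closed. [this work] -/
def allButOne (k : ℕ) : Set (Set (Fin k)) := {S | ∀ i j, i ∉ S → j ∉ S → i = j}

/-- The pattern with exactly the coordinate `i` closed. [this work] -/
def cofin (i : Fin k) : Set (Fin k) := {j | j ≠ i}

/-- The cylinder of patterns containing `S`. [this work] -/
def cyl (S : Set (Fin k)) : Set (Set (Fin k)) := {T | S ⊆ T}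

/-- Membership in `cofin`. [this work] -/
@[simp] theorem mem_cofin {i j : Fin k} : j ∈ cofin i ↔ j ≠ i := Iff.rfl

/-- `i ∉ cofin i`. [this work] -/
theorem not_mem_cofin (i : Fin k) : i ∉ cofin i := fun h => h rfl

/-- `cofin i ≠ ⊤`. [this work] -/
theorem cofin_ne_univ (i : Fin k) : cofin i ≠ Set.univ := fun h => not_mem_cofin i (h ▸ Set.mem_univ i)

/-- `cofin` is injective. [this work] -/
theorem cofin_injective : Function.Injective (cofin (k := k)) := by
  intro i j h
  by_contra hne
  have : i ∈ cofin j := hne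
  rw [← h] at this
  exact not_mem_cofin i this

/-- The patterns of `allButOne k` are `⊤` and the `cofin i`. [this work] -/
theorem mem_allButOne_iff {T : Set (Fin k)} : T ∈ allButOne k ↔ T = Set.univ ∨ ∃ i, T = cofin i := by
  constructor
  · intro hT
    by_cases h : T = Set.univ
    · exact Or.inl h
    · obtain ⟨i, hi⟩ : ∃ i, i ∉ T := by
        by_contra hall; push Not at hall; exact h (Set.eq_univ_of_forall hall)
      refine Or.inr ⟨i, Set.ext fun j => ⟨fun hj hji => hi (hji ▸ hj), fun hji => ?_⟩⟩
      by_contra hj; exact hji (hT j i hj hi)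
  · rintro (rfl | ⟨i, rfl⟩)
    · intro i j hi _; exact (hi (Set.mem_univ i)).elim
    · intro a b ha hb
      simp only [mem_cofin, ne_eq, not_not] at ha hb
      rw [ha, hb]

/-- `⊤ ∈ allButOne k`. [this work] -/
theorem univ_mem_allButOne : (Set.univ : Set (Fin k)) ∈ allButOne k := mem_allButOne_iff.2 (Or.inl rfl)

/-- `cofin i ∈ allButOne k`. [this work] -/
theorem cofin_mem_allButOne (i : Fin k) : cofin i ∈ allButOne k := mem_allButOne_iff.2 (Or.inr ⟨i, rfl⟩)

/-- `allButOne k` is increasing. [this work] -/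
theorem isUpperSet_allButOne : IsUpperSet (allButOne k) :=
  fun _ _ hle hS i j hi hj => hS i j (fun h => hi (hle h)) (fun h => hj (hle h))

/-- Cylinders are increasing. [this work] -/
theorem isUpperSet_cyl (S : Set (Fin k)) : IsUpperSet (cyl S) := fun _ _ hle hT => Set.Subset.trans hT hle

/-- The indicator of `allButOne k ∩ 𝒴` splits over the `k + 1` patterns. [this work] -/
theorem ind_allButOne_mul (𝒴 : Set (Set (Fin k))) (T : Set (Fin k)) :
    ind (allButOne k) T * ind 𝒴 T =
      (if T = Set.univ then ind 𝒴 Set.univ else 0) + ∑ i, (if T = cofin i then ind 𝒴 (cofin i) else 0) := by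
  by_cases hT : T ∈ allButOne k
  · rw [ind_of_mem hT, one_mul]
    rcases mem_allButOne_iff.1 hT with rfl | ⟨i, rfl⟩
    · rw [if_pos rfl, sum_eq_zero fun i _ => if_neg (cofin_ne_univ i).symm, add_zero]
    · rw [if_neg (cofin_ne_univ i), zero_add, sum_eq_single i (fun j _ hji => if_neg fun h => hji (cofin_injective h).symm)
        (fun h => (h (mem_univ i)).elim), if_pos rfl]
  · rw [ind_of_not_mem hT, zero_mul]
    have h1 : T ≠ Set.univ := fun h => hT (h ▸ univ_mem_allButOne)
    have h2 : ∀ i, T ≠ cofin i := fun i h => hT (h ▸ cofin_mem_allButOne i)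
    rw [if_neg h1, sum_eq_zero fun i _ => if_neg (h2 i), add_zero]

/-! ### Weights -/

variable (q : Fin k → unitInterval)

/-- `W = w(⊤) = ∏ q_i`. [this work] -/
def W : ℝ := bernoulliWeight q Set.univ

/-- `w(⊤∖i)`. [this work] -/
def wco (i : Fin k) : ℝ := bernoulliWeight q (cofin i)

/-- The odds of being closed, `r_i = (1 − q_i)/q_i`. [this work] -/
def r (i : Fin k) : ℝ := (1 - (q i : ℝ)) / (q i : ℝ)

/-- `π = Σ_i w(⊤∖i)` (the weight of "exactly one closed"). [this work] -/
def piOne : ℝ := ∑ i, wco q i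

/-- **The certificate**: `ρ = μ(· | exactly one coordinate closed)`. [this work] -/
def rho (T : Set (Fin k)) : ℝ := ∑ i, (if T = cofin i then wco q i / piOne q else 0)

/-- The product weight of a pattern, unfolded. [folklore] -/
theorem bw_apply (S : Set (Fin k)) : bernoulliWeight q S = ∏ e, (if e ∈ S then (q e : ℝ) else 1 - (q e : ℝ)) := rfl

/-- `W = ∏ q_i`. [this work] -/
theorem W_eq : W q = ∏ i, (q i : ℝ) := by
  unfold W
  rw [bw_apply]
  exact prod_congr rfl fun e _ => if_pos (Set.mem_univ e)

/-- `w(⊤∖i) = (1 − q_i) ∏_{j ≠ i} q_j`. [this work] -/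
theorem wco_eq (i : Fin k) : wco q i = (1 - (q i : ℝ)) * ∏ j ∈ univ.erase i, (q j : ℝ) := by
  unfold wco
  rw [bw_apply, ← mul_prod_erase univ _ (mem_univ i), if_neg (not_mem_cofin i)]
  congr 1
  exact prod_congr rfl fun j hj => if_pos (show j ∈ cofin i from ne_of_mem_erase hj)

/-- `w(𝒴 ∩ H_k)`-type probabilities: `w(allButOne ∩ 𝒴) = W·1_𝒴(⊤) + Σ_i w(⊤∖i)·1_𝒴(⊤∖i)`. [this work] -/
theorem pr_allButOne_inter (𝒴 : Set (Set (Fin k))) :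
    pr q (allButOne k ∩ 𝒴) = W q * ind 𝒴 Set.univ + ∑ i, wco q i * ind 𝒴 (cofin i) := by
  rw [pr_eq_sum]
  simp only [ind_inter, ind_allButOne_mul]
  rw [show (∑ T, bernoulliWeight q T * ((if T = Set.univ then ind 𝒴 Set.univ else 0) + ∑ i, if T = cofin i then ind 𝒴 (cofin i) else 0)) =
      (∑ T, bernoulliWeight q T * (if T = Set.univ then ind 𝒴 Set.univ else 0)) +
        ∑ T, ∑ i, bernoulliWeight q T * (if T = cofin i then ind 𝒴 (cofin i) else 0) from by
    rw [← sum_add_distrib]; exact sum_congr rfl fun T _ => by rw [mul_add, mul_sum]]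
  congr 1
  · rw [show (∑ T, bernoulliWeight q T * (if T = Set.univ then ind 𝒴 Set.univ else 0)) =
        ∑ T, (if T = Set.univ then bernoulliWeight q T * ind 𝒴 Set.univ else 0) from sum_congr rfl fun T _ => by
      split_ifs <;> simp]
    rw [sum_ite_eq' univ (Set.univ : Set (Fin k)) (fun T => bernoulliWeight q T * ind 𝒴 Set.univ), if_pos (mem_univ _)]
    rfl
  · rw [sum_comm]
    refine sum_congr rfl fun i _ => ?_
    rw [show (∑ T, bernoulliWeight q T * (if T = cofin i then ind 𝒴 (cofin i) else 0)) =
        ∑ T, (if T = cofin i then bernoulliWeight q T * ind 𝒴 (cofin i) else 0) from sum_congr rfl fun T _ => by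
      split_ifs <;> simp]
    rw [sum_ite_eq' univ (cofin i) (fun T => bernoulliWeight q T * ind 𝒴 (cofin i)), if_pos (mem_univ _)]
    rfl

/-- `θ = w(allButOne k) = W + π`. [this work] -/
theorem pr_allButOne : pr q (allButOne k) = W q + piOne q := by
  have h := pr_allButOne_inter q Set.univ
  rw [Set.inter_univ] at h
  rw [h, ind_of_mem (Set.mem_univ _), mul_one, piOne]
  exact congrArg _ (sum_congr rfl fun i _ => by rw [ind_of_mem (Set.mem_univ _), mul_one])

/-- `Σ_T ρ(T) g(T) = Σ_i (w(⊤∖i)/π) g(⊤∖i)`. [this work] -/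
theorem sum_rho_mul (g : Set (Fin k) → ℝ) : ∑ T, rho q T * g T = ∑ i, wco q i / piOne q * g (cofin i) := by
  unfold rho
  rw [show (∑ T, (∑ i, if T = cofin i then wco q i / piOne q else 0) * g T) =
      ∑ T, ∑ i, (if T = cofin i then wco q i / piOne q * g (cofin i) else 0) from sum_congr rfl fun T _ => by
    rw [sum_mul]; exact sum_congr rfl fun i _ => by split_ifs with h <;> simp [h]]
  rw [sum_comm]
  exact sum_congr rfl fun i _ => by rw [sum_ite_eq' univ (cofin i), if_pos (mem_univ _)]

/-! ### Trace reduction: cores and cylinders -/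

/-- The set of coordinates `i` with `⊤∖i ∈ 𝒳` (as a finset). [this work] -/
def live (𝒳 : Set (Set (Fin k))) : Finset (Fin k) := univ.filter fun i => cofin i ∈ 𝒳

/-- Membership in `live`. [this work] -/
theorem mem_live {𝒳 : Set (Set (Fin k))} {i : Fin k} : i ∈ live 𝒳 ↔ cofin i ∈ 𝒳 := by simp [live]

/-- An increasing family lies in the cylinder over the complement of its live set. [this work] -/
theorem subset_cyl_of_isUpperSet {𝒳 : Set (Set (Fin k))} (h𝒳 : IsUpperSet 𝒳) : 𝒳 ⊆ cyl (↑(live 𝒳)ᶜ : Set (Fin k)) := by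
  intro ω hω i hi
  rw [mem_coe, mem_compl, mem_live] at hi
  by_contra hiω
  exact hi (h𝒳 (show ω ⊆ cofin i from fun j hj hji => hiω (hji ▸ hj)) hω)

/-- The cylinder over the complement of the live set has the same live set. [this work] -/
theorem ind_cyl_cofin (A : Finset (Fin k)) (i : Fin k) : ind (cyl (↑Aᶜ : Set (Fin k))) (cofin i) = if i ∈ A then 1 else 0 := by
  by_cases hi : i ∈ A
  · rw [if_pos hi, ind_of_mem]
    intro j hj
    rw [mem_coe, mem_compl] at hj
    exact fun hji => hj (hji ▸ hi)
  · rw [if_neg hi, ind_of_not_mem]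
    intro h
    exact not_mem_cofin i (h (by rw [mem_coe, mem_compl]; exact hi))

/-- The live indicators of a family as an `if`. [this work] -/
theorem ind_cofin_eq (𝒳 : Set (Set (Fin k))) (i : Fin k) : ind 𝒳 (cofin i) = if cofin i ∈ 𝒳 then 1 else 0 := by
  by_cases h : cofin i ∈ 𝒳
  · rw [ind_of_mem h, if_pos h]
  · rw [ind_of_not_mem h, if_neg h]

/-- Sums against the live indicators are sums over the live set. [this work] -/
theorem sum_mul_ind_cofin (𝒳 : Set (Set (Fin k))) (f : Fin k → ℝ) : ∑ i, f i * ind 𝒳 (cofin i) = ∑ i ∈ live 𝒳, f i := by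
  rw [live, sum_filter]
  exact sum_congr rfl fun i _ => by rw [ind_cofin_eq]; split_ifs <;> simp

/-- `w(H_k ∩ 𝒳) = W + Σ_{i ∈ live 𝒳} w(⊤∖i)` for a nonempty up-set. [this work] -/
theorem pr_allButOne_inter_eq_live {𝒳 : Set (Set (Fin k))} (h𝒳 : IsUpperSet 𝒳) (hne : 𝒳.Nonempty) :
    pr q (allButOne k ∩ 𝒳) = W q + ∑ i ∈ live 𝒳, wco q i := by
  have huniv : Set.univ ∈ 𝒳 := by obtain ⟨ω, hω⟩ := hne; exact h𝒳 (Set.subset_univ ω) hω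
  rw [pr_allButOne_inter, ind_of_mem huniv, mul_one, sum_mul_ind_cofin]

/-- `w(H_k ∩ C) = W + Σ_{i ∈ A} w(⊤∖i)` for the cylinder over `Aᶜ`. [this work] -/
theorem pr_allButOne_inter_cyl (A : Finset (Fin k)) :
    pr q (allButOne k ∩ cyl (↑Aᶜ : Set (Fin k))) = W q + ∑ i ∈ A, wco q i := by
  rw [pr_allButOne_inter, ind_of_mem (show Set.univ ∈ cyl (↑Aᶜ : Set (Fin k)) from Set.subset_univ _), mul_one]
  congr 1
  rw [← sum_filter_add_sum_filter_not univ (fun i => i ∈ A)]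
  have h1 : (univ.filter fun i => i ∈ A) = A := by ext i; simp
  rw [h1, sum_eq_zero (s := univ.filter fun i => ¬ i ∈ A) (fun i hi => by
    rw [ind_cyl_cofin, if_neg (mem_filter.1 hi).2, mul_zero]), add_zero]
  exact sum_congr rfl fun i hi => by rw [ind_cyl_cofin, if_pos hi, mul_one]

/-- `Σ ρ·1_{𝒳}` in terms of the live set. [this work] -/
theorem sum_rho_ind {𝒳 : Set (Set (Fin k))} : ∑ T, rho q T * ind 𝒳 T = ∑ i ∈ live 𝒳, wco q i / piOne q := by
  rw [sum_rho_mul, sum_mul_ind_cofin]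

/-- The live set of an intersection. [this work] -/
theorem live_inter (𝒳 𝒵 : Set (Set (Fin k))) : live (𝒳 ∩ 𝒵) = live 𝒳 ∩ live 𝒵 := by
  ext i; simp [live, Set.mem_inter_iff]

/-- The cylinder probability: `w(cyl S) = ∏_{i∈S} q_i`. [this work] -/
theorem pr_cyl (S : Finset (Fin k)) : pr q (cyl (↑S : Set (Fin k))) = ∏ i ∈ S, (q i : ℝ) := by
  have h := pr_cylinder q S (Set.univ : Set (Fin k))
  have hset : {α : Set (Fin k) | α ∩ ↑S = Set.univ ∩ ↑S} = cyl (↑S : Set (Fin k)) := by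
    ext α
    simp only [Set.mem_setOf_eq, Set.univ_inter, cyl]
    exact Set.inter_eq_right
  rw [hset] at h
  rw [h]
  exact prod_congr rfl fun e _ => if_pos (Set.mem_univ e)

/-! ### The weights in terms of the odds (interior parameters) -/

section Interior

variable {q} (hq : ∀ i, 0 < (q i : ℝ) ∧ (q i : ℝ) < 1)
include hq

/-- `W > 0`. [this work] -/
theorem W_pos : 0 < W q := by rw [W_eq]; exact prod_pos fun i _ => (hq i).1

/-- `r_i ≥ 0`. [this work] -/
theorem r_nonneg (i : Fin k) : 0 ≤ r q i := div_nonneg (by linarith [(hq i).2]) (hq i).1.le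

/-- `r_i > 0`. [this work] -/
theorem r_pos (i : Fin k) : 0 < r q i := div_pos (by linarith [(hq i).2]) (hq i).1

/-- `w(⊤∖i) = W · r_i`. [this work] -/
theorem wco_eq_W_mul_r (i : Fin k) : wco q i = W q * r q i := by
  rw [wco_eq, W_eq, ← mul_prod_erase univ (fun j => (q j : ℝ)) (mem_univ i), r]
  have hqi : (q i : ℝ) ≠ 0 := (hq i).1.ne'
  field_simp

/-- `q_i (1 + r_i) = 1`. [this work] -/
theorem q_mul_one_add_r (i : Fin k) : (q i : ℝ) * (1 + r q i) = 1 := by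
  have hqi : (q i : ℝ) ≠ 0 := (hq i).1.ne'
  rw [r]; field_simp; ring

/-- `w(cyl Aᶜ) = W · ∏_{i∈A} (1 + r_i)`. [this work] -/
theorem pr_cyl_compl (A : Finset (Fin k)) : pr q (cyl (↑Aᶜ : Set (Fin k))) = W q * ∏ i ∈ A, (1 + r q i) := by
  rw [pr_cyl, W_eq, ← prod_mul_prod_compl A (fun i => (q i : ℝ)), mul_comm (∏ i ∈ A, (q i : ℝ)), mul_assoc, ← prod_mul_distrib,
    prod_congr rfl fun i _ => q_mul_one_add_r hq i, prod_const_one, mul_one]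

/-- `W · ∏_i (1 + r_i) = 1`. [this work] -/
theorem W_mul_prod : W q * ∏ i, (1 + r q i) = 1 := by
  rw [W_eq, ← prod_mul_distrib, prod_congr rfl fun i _ => q_mul_one_add_r hq i, prod_const_one]

/-- `π = W · Σ r_i`. [this work] -/
theorem piOne_eq : piOne q = W q * ∑ i, r q i := by
  rw [piOne, mul_sum]; exact sum_congr rfl fun i _ => wco_eq_W_mul_r hq i

/-- `π > 0` (nonempty block). [this work] -/
theorem piOne_pos (hk : 0 < k) : 0 < piOne q := by
  rw [piOne_eq hq]
  exact mul_pos (W_pos hq) (sum_pos (fun i _ => r_pos hq i) ⟨⟨0, hk⟩, mem_univ _⟩)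

/-- `θ = W (1 + σ)`. [this work] -/
theorem pr_allButOne_eq : pr q (allButOne k) = W q * (1 + ∑ i, r q i) := by
  rw [pr_allButOne, piOne_eq hq]; ring

end Interior

/-! ### Region bookkeeping -/

/-- `∏_A = ∏_{A∖B} · ∏_{A∩B}`. [this work] -/
theorem prod_split_left (A B : Finset (Fin k)) (f : Fin k → ℝ) : ∏ i ∈ A, f i = (∏ i ∈ A \ B, f i) * ∏ i ∈ A ∩ B, f i := by
  rw [← prod_union (disjoint_sdiff_inter A B), sdiff_union_inter]

/-- `∏_B = ∏_{B∖A} · ∏_{A∩B}`. [this work] -/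
theorem prod_split_right (A B : Finset (Fin k)) (f : Fin k → ℝ) : ∏ i ∈ B, f i = (∏ i ∈ B \ A, f i) * ∏ i ∈ A ∩ B, f i := by
  rw [inter_comm, ← prod_union (disjoint_sdiff_inter B A), sdiff_union_inter]

/-- `Σ_A = Σ_{A∖B} + Σ_{A∩B}`. [this work] -/
theorem sum_split_left (A B : Finset (Fin k)) (f : Fin k → ℝ) : ∑ i ∈ A, f i = (∑ i ∈ A \ B, f i) + ∑ i ∈ A ∩ B, f i := by
  rw [← sum_union (disjoint_sdiff_inter A B), sdiff_union_inter]

/-- `Σ_B = Σ_{B∖A} + Σ_{A∩B}`. [this work] -/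
theorem sum_split_right (A B : Finset (Fin k)) (f : Fin k → ℝ) : ∑ i ∈ B, f i = (∑ i ∈ B \ A, f i) + ∑ i ∈ A ∩ B, f i := by
  rw [inter_comm, ← sum_union (disjoint_sdiff_inter B A), sdiff_union_inter]

/-- Splitting a product over the whole block into the four regions of a pair `(A, B)`. [this work] -/
theorem prod_four_regions (A B : Finset (Fin k)) (f : Fin k → ℝ) :
    ∏ i, f i = (∏ i ∈ (A ∪ B)ᶜ, f i) * (∏ i ∈ A \ B, f i) * (∏ i ∈ B \ A, f i) * (∏ i ∈ A ∩ B, f i) := by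
  have e1 : ∏ i, f i = (∏ i ∈ A ∪ B, f i) * ∏ i ∈ (A ∪ B)ᶜ, f i := (prod_mul_prod_compl (A ∪ B) f).symm
  have e2 : ∏ i ∈ A ∪ B, f i = (∏ i ∈ A \ B, f i) * ∏ i ∈ B, f i := by
    rw [← sdiff_union_self_eq_union, prod_union sdiff_disjoint]
  rw [e1, e2, prod_split_right A B f]
  ring

/-- Splitting a sum over the whole block into the four regions of a pair `(A, B)`. [this work] -/
theorem sum_four_regions (A B : Finset (Fin k)) (f : Fin k → ℝ) :
    ∑ i, f i = (∑ i ∈ (A ∪ B)ᶜ, f i) + (∑ i ∈ A \ B, f i) + (∑ i ∈ B \ A, f i) + (∑ i ∈ A ∩ B, f i) := by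
  have e1 : ∑ i, f i = (∑ i ∈ A ∪ B, f i) + ∑ i ∈ (A ∪ B)ᶜ, f i := (sum_add_sum_compl (A ∪ B) f).symm
  have e2 : ∑ i ∈ A ∪ B, f i = (∑ i ∈ A \ B, f i) + ∑ i ∈ B, f i := by
    rw [← sdiff_union_self_eq_union, sum_union sdiff_disjoint]
  rw [e1, e2, sum_split_right A B f]
  ring

end SahiAllButOne

end Summit.CriticalPhenomena.PercolationContinuityZ3.Theorems
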